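import Literature.NumberTheory.Automorphic.StrongArtinGL2
import Literature.NumberTheory.GaloisRepresentations.HeckeCharacterNormCharacter
import HarnessLib

/-!
# Booker–Krishnamurthy: Galois representations all of whose unramified twists have entire
# `L`-functions are automorphic (the `GL(2)` converse theorem with arbitrary ramified twists)

A. R. Booker, M. Krishnamurthy, *A strengthening of the GL(2) converse theorem*, Compositio
Math. 147 (2011), 669–715 [BookerKrishnamurthy2011], read on the held text
`paper:doi-10-1112-s0010437x10005087`, p. 670:

> **Theorem 1.1.** Let `F` be a number field, `𝔸_F` its ring of adèles and `π = ⊗_v π_v` an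
> irreducible, admissible, generic representation of `GL₂(𝔸_F)` with central idèle class
> character `ω_π`, such that `π_v` is unitary for all archimedean places `v`. For every (unitary)
> idèle class character `ω`, suppose that the complete `L`-functions
> `Λ(s, π ⊗ ω) = ∏_v L(s, π_v ⊗ ω_v)` and `Λ(s, π̃ ⊗ ω⁻¹) = ∏_v L(s, π̃_v ⊗ ω_v⁻¹)`
> (i) converge absolutely and define analytic functions in some right half-plane `re s > σ`;
> (ii) continue meromorphically to ratios of entire functions of finite order; (iii) satisfy the
> functional equation `Λ(s, π ⊗ ω) = ε(s, π ⊗ ω) Λ(1 - s, π̃ ⊗ ω⁻¹)`, where `ε(s, π ⊗ ω)` is as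
> in [JL70, Theorem 11.3]; (iv) are entire whenever `ω` is unramified at every non-archimedean
> place. Then `π` is an automorphic representation.
>
> **Corollary 1.2.** Let `ρ : W_F → GL₂(ℂ)` be a representation of the Weil group of `F`.
> Suppose that the associated `L`-functions `Λ(s, ρ ⊗ ω)` are entire for all idèle class
> characters `ω` that are unramified at every non-archimedean place. Then `ρ` is automorphic,
> i.e. there is an automorphic representation `π` such that `π_v` corresponds to `ρ_v` under the
> local Langlands correspondence for each place `v`.

("By a character we always mean a unitary character", op. cit. p. 672.) The refinement Bull. LMS 45
(2013) 987–1003 [BookerKrishnamurthy2013BLMS], Thm. 1.1, drops the unitarity of `π_∞`, weakens (ii)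
to meromorphy on `ℂ` and lets a twisted Dirichlet polynomial `D(s, ω)` kill finitely many poles of
the unramified twists; its corrigendum (Bull. LMS 47 (2015) 675–676, doi:10.1112/blms/bdv038)
"corrects an error in the proof of Lemma 2.4" (zbMATH), so the 2013 statement stands. Neither
Theorem 1.1 is vendored HERE: both quantify over an abstract irreducible admissible generic
`π = ⊗_v π_v` with the Jacquet–Langlands `L`- and `ε`-factors of its `GL₁`-twists at EVERY place,
and the tree has no archimedean carrier for that (no `L`- or `ε`-factors of `(𝔤, K)`-modules, no
archimedean Whittaker models; at finite places `SmoothIrrep`, `HasRSLFactor`, `HasRSEpsilon`,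
`LocalLanglandsDatum` exist). What IS vendored is **Corollary 1.2 for Galois (Artin)
representations** `σ : Γ_F → GL₂(ℂ)` (the Weil-group representations of finite image — the case
carrying the content, induced-from-`GL₁` and reducible Weil representations being automorphic by
Jacquet–Langlands §12 and Eisenstein series), as the named fact
`bookerKrishnamurthy_isPiOfArtinRep_of_entire_twists`, over the accepted carriers:

* `σ : FramedArtinRep F 2` (continuous `Γ_F →ₜ* GL₂(ℂ)`, `GaloisRepresentations/ArtinLFunction`);
* twists by `ω : HeckeCharacter F`, `ω.IsUnitary`, `ω.IsUnramifiedAt v` for every finite `v`;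
* the complete twisted `L`-function `Λ(s, σ ⊗ ω) = ∏_{w ∣ ∞} L(s, σ_w ⊗ ω_w) · ∏_{v ∤ ∞}
  det(1 - ω_v(ϖ_v) q_v^{-s} Frob_v | V^{I_v})⁻¹` (`artinTwistCompletedL`), built from the accepted
  local Euler factors `ArtinRep.eulerFactorAt` (all finite places, inertia invariants), the accepted
  `ω.valueAtUniformizer v`, the accepted signature `ArtinRep.signature` of `σ` at the real places,
  and the archimedean components `ω_w` (NEW: `HeckeCharacter.archComponent`) through their
  Booker–Krishnamurthy parameters (NEW: `HasRealParam`, `HasComplexParam`; op. cit. §1.1, p. 672: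
  `χ_w(y) = ‖y‖_w^ν sgn_w(y)^ε`, `ε ∈ {0, 1}`, at a real place; `χ_w(y) = ‖y‖_w^ν θ_w(y)^k`,
  `θ_w(y) = y ‖y‖_w^{-1/2}`, `k ∈ ℤ`, at a complex place, `‖·‖_w` the normalised absolute value),
  with Tate's archimedean factors `L(s, ‖·‖^ν sgn^ε) = Γ_ℝ(s + ν + ε)`,
  `L(s, ‖·‖_ℂ^ν θ^k) = Γ_ℂ(s + ν + |k|/2)` (normalisation checked on op. cit. §4.2, pp. 683–685);
* "entire" as the accepted `LFunction.HasEntireContinuation` (`∃ g` entire, `= Λ` on `re s > 1`);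
* the conclusion "automorphic, `π_v ↔ ρ_v` at each `v`" as its accepted almost-everywhere
  unramified shadow `IsPiOfArtinRep σ π` (`Automorphic/StrongArtinGL2`) for SOME Borel–Jacquet
  automorphic representation datum `π : AutomorphicRepData (AutomorphyDatum.gl 2 F hcpt)`, NOT
  asserted cuspidal (op. cit. Remark (i): "`π` need not be cuspidal") — implied by, hence at most as
  strong as, the printed conclusion.

## Conventions (review note)

`ArtinRep.eulerFactorAt` and `IsPiOfArtinRep` both use the ARITHMETIC Frobenius, and
`valueAtUniformizer` pairs `ω` with uniformisers. Replacing `σ` by its contragredient `σ^∨`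
(`σ^∨(Frob_geom) = σ(Frob_arith)ᵀ` on `(V^∨)^{I} = (V^{I})^∨`, same signature at real places) turns
every clause into Deligne's geometric normalisation (uniformiser ↔ geometric Frobenius), under
which `artinTwistCompletedL σ P ω = Λ(s, σ^∨ ⊗ ω)` literally; the hypothesis ranges over ALL
unitary everywhere-unramified `ω` and the conclusion is an existence statement read in the same
(arithmetic) convention, so the vendored statement is the printed one for `σ^∨`, i.e. equivalent to
it (cf. the identical remark in `Automorphic/StrongArtinGL2`, §Normalisations). The archimedean
parameters enter through `∀ P, ω.HasArchParams P → …`; for unitary `ω` they exist and are unique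
("may be written uniquely in the form", op. cit. p. 672), so this clause is neither vacuous nor a
weakening; the classification of characters of `ℝˣ`, `ℂˣ` is not needed to STATE the fact.

Sanity lemmas: `artinTwistGammaFactor_zero` (`P = 0` gives the accepted `ArtinRep.gammaFactor`),
`artinTwistLFunction_one` (`ω = 1` gives the accepted `artinLFunction`), so the instance `ω = 1` of
the hypothesis is Artin's conjecture for `σ` itself (`hasEntireContinuation_of_hypothesis`).
Not here: Theorem 1.1 (2011/2013) for general `π`; the partial-`L`-function variant of the 2013
paper; cuspidality of `π` (Jacquet–Langlands Thm. 10.10).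

## References

* A. R. Booker, M. Krishnamurthy, Compositio Math. 147 (2011), Thm. 1.1, Cor. 1.2, Remarks
  (i)–(ii) (p. 670), §1.1 (p. 672), §4.2 (pp. 683–685). [BookerKrishnamurthy2011]
* A. R. Booker, M. Krishnamurthy, Bull. LMS 45 (2013), Thm. 1.1; corrigendum Bull. LMS 47 (2015)
  675–676. [BookerKrishnamurthy2013BLMS]
* J. Tate, *Number theoretic background*, Corvallis 1979, §3. [TateCorvallis1979]
* H. Jacquet, R. P. Langlands, *Automorphic forms on GL(2)*, LNM 114 (1970), Thm. 11.3, §12.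
  [JacquetLanglands1970]
-/

noncomputable section

open scoped MatrixGroups NumberField Classical
open NumberField NumberField.InfinitePlace IsDedekindDomain Complex Module
open Literature.NumberTheory.GaloisRepresentations

namespace Literature.NumberTheory.Automorphic

universe u

/-! ### Archimedean components of idèle class characters -/

section ArchComponent

variable {K : Type u} [Field K] [NumberField K]

/-- The **idèle supported at the infinite place `w`**: `F_wˣ → 𝕀_F`, `y ↦` the idèle equal to `y`
at `w` and to `1` at every other place (Mathlib `MonoidHom.mulSingle` into
`InfiniteAdeleRing K = Π_w K_w`, then the accepted `infiniteIdeles`). Booker–Krishnamurthy 2011,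
§1.1 (`𝔸_F = F_∞ × 𝔸_{F,f}`). [folklore] -/
def infiniteIdeleSingle (w : InfinitePlace K) : (w.Completion)ˣ →* ideleGroup K :=
  (infiniteIdeles K).comp
    (Units.map (MonoidHom.mulSingle (fun v : InfinitePlace K => v.Completion) w :
      w.Completion →* InfiniteAdeleRing K))

/-- The `w`-component of `infiniteIdeleSingle w y` is `y`. [folklore] -/
@[simp]
theorem infiniteIdeleSingle_fst_self (w : InfinitePlace K) (y : (w.Completion)ˣ) :
    ((infiniteIdeleSingle w y : ideleGroup K) : AdeleRing (𝓞 K) K).1 w = y :=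
  Pi.mulSingle_eq_same (M := fun v : InfinitePlace K => v.Completion) w (y : w.Completion)

/-- The components of `infiniteIdeleSingle w y` at the infinite places `w' ≠ w` are `1`.
[folklore] -/
theorem infiniteIdeleSingle_fst_of_ne {w w' : InfinitePlace K} (y : (w.Completion)ˣ)
    (h : w' ≠ w) : ((infiniteIdeleSingle w y : ideleGroup K) : AdeleRing (𝓞 K) K).1 w' = 1 :=
  Pi.mulSingle_eq_of_ne (M := fun v : InfinitePlace K => v.Completion) h (y : w.Completion)

/-- The finite part of `infiniteIdeleSingle w y` is `1`. [folklore] -/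
@[simp]
theorem infiniteIdeleSingle_snd (w : InfinitePlace K) (y : (w.Completion)ˣ) :
    ((infiniteIdeleSingle w y : ideleGroup K) : AdeleRing (𝓞 K) K).2 = 1 :=
  rfl

/-- The **archimedean component** `ω_w : F_wˣ → ℂˣ` of an idèle class character `ω` at the
infinite place `w`: `ω_w = ω ∘ infiniteIdeleSingle w` (the counterpart of the accepted
`HeckeCharacter.localComponent` at finite places). Booker–Krishnamurthy 2011, §1.1, p. 672;
Tate's thesis §4.3. Declared by its absolute name as a dot-notation extension of the accepted
structure `HeckeCharacter` of `GaloisRepresentations/HeckeCharacter`. [cite: TateThesis1967, §4.3] -/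
def _root_.Literature.NumberTheory.GaloisRepresentations.HeckeCharacter.archComponent
    (ω : HeckeCharacter K) (w : InfinitePlace K) : (w.Completion)ˣ →* ℂˣ :=
  ω.toContinuousMonoidHom.toMonoidHom.comp (infiniteIdeleSingle w)

/-- Unfolding `archComponent`. [folklore] -/
@[simp]
theorem _root_.Literature.NumberTheory.GaloisRepresentations.HeckeCharacter.archComponent_apply
    (ω : HeckeCharacter K) (w : InfinitePlace K) (y : (w.Completion)ˣ) :
    ω.archComponent w y = ω (infiniteIdeleSingle w y) := rfl

/-- The archimedean components of the trivial character are trivial. [folklore] -/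
@[simp]
theorem _root_.Literature.NumberTheory.GaloisRepresentations.HeckeCharacter.archComponent_one
    (w : InfinitePlace K) : (1 : HeckeCharacter K).archComponent w = 1 := by
  ext y
  simp

/-- **Booker–Krishnamurthy parameters of a character of `F_wˣ` at a real place `w`**
(op. cit. §1.1, p. 672: "for `v ∈ S_ℝ`, `χ_v` may be written uniquely in the form
`χ_v(y) = ‖y‖_v^{ν(χ_v)} sgn_v(y)^{ε(χ_v)}`, where `sgn_v : F_vˣ → {±1}` is the local sign
character, `ν(χ_v) ∈ ℂ` and `ε(χ_v) ∈ {0, 1}`"): `χ` has parameters `(ν, ε)` when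
`χ(y) = ‖y‖^ν · sgn(y)^ε` for all `y ∈ F_wˣ`, the sign being read through Mathlib's
`extensionEmbeddingOfIsReal hw : F_w →+* ℝ` and `‖·‖` the norm of `w.Completion` (`= |·|` on `ℝ`).
[cite: BookerKrishnamurthy2011, §1.1 (p. 672)] -/
def HasRealParam {w : InfinitePlace K} (hw : w.IsReal) (χ : (w.Completion)ˣ →* ℂˣ) (ν : ℂ)
    (ε : Fin 2) : Prop :=
  ∀ y : (w.Completion)ˣ,
    (χ y : ℂ) = ((‖(y : w.Completion)‖ : ℂ) ^ ν) *
      ((SignType.sign (Completion.extensionEmbeddingOfIsReal hw (y : w.Completion))) : ℂ) ^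
        (ε : ℕ)

/-- **Booker–Krishnamurthy parameters of a character of `F_wˣ` at a complex place `w`**
(op. cit. §1.1, p. 672: "for `v ∈ S_ℂ`, `χ_v(y) = ‖y‖_v^{ν(χ_v)} θ_v(y)^{k(χ_v)}`, where
`θ_v(y) = y ‖y‖_v^{-1/2}`, `ν(χ_v) ∈ ℂ` and `k(χ_v) ∈ ℤ`", with `‖y‖_v = |y|²` the normalised
absolute value of `F_v ≅ ℂ`): `χ(y) = (|y|²)^ν · (y / |y|)^k` for all `y ∈ F_wˣ`, read through
Mathlib's `extensionEmbedding w : F_w →+* ℂ` (an isometry, so `|y| = ‖y‖`).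
[cite: BookerKrishnamurthy2011, §1.1 (p. 672)] -/
def HasComplexParam {w : InfinitePlace K} (χ : (w.Completion)ˣ →* ℂˣ) (ν : ℂ) (k : ℤ) : Prop :=
  ∀ y : (w.Completion)ˣ,
    (χ y : ℂ) = (((‖(y : w.Completion)‖ ^ 2 : ℝ) : ℂ) ^ ν) *
      (Completion.extensionEmbedding w (y : w.Completion) / (‖(y : w.Completion)‖ : ℂ)) ^ k

variable (K) in
/-- A family of **archimedean parameters** indexed by the infinite places of `K`: exponents
`ν_w ∈ ℂ`, parities `ε_w ∈ {0, 1}` (read at the real places) and integers `k_w` (read at the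
complex places). Booker–Krishnamurthy 2011, §1.1. [cite: BookerKrishnamurthy2011, §1.1 (p. 672)] -/
structure ArchParams where
  /-- The exponents `ν_w`. -/
  ν : InfinitePlace K → ℂ
  /-- The parities `ε_w ∈ {0, 1}` at the real places. -/
  ε : InfinitePlace K → Fin 2
  /-- The integers `k_w` at the complex places. -/
  k : InfinitePlace K → ℤ

/-- The zero parameters (`ν = 0`, `ε = 0`, `k = 0`: the trivial character at every infinite place).
[folklore] -/
instance : Zero (ArchParams K) := ⟨⟨0, 0, 0⟩⟩

omit [NumberField K] in
/-- The zero parameters have `ν = 0`. [folklore] -/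
@[simp] theorem ArchParams.zero_ν : (0 : ArchParams K).ν = 0 := rfl

omit [NumberField K] in
/-- The zero parameters have `ε = 0`. [folklore] -/
@[simp] theorem ArchParams.zero_ε : (0 : ArchParams K).ε = 0 := rfl

omit [NumberField K] in
/-- The zero parameters have `k = 0`. [folklore] -/
@[simp] theorem ArchParams.zero_k : (0 : ArchParams K).k = 0 := rfl

/-- The idèle class character `ω` **has archimedean parameters `P`**: at every real place `w`,
`ω_w(y) = ‖y‖^{ν_w} sgn(y)^{ε_w}`, and at every complex place `w`, `ω_w(y) = ‖y‖_w^{ν_w} θ_w(y)^{k_w}`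
(Booker–Krishnamurthy 2011, §1.1, p. 672). [cite: BookerKrishnamurthy2011, §1.1 (p. 672)] -/
def _root_.Literature.NumberTheory.GaloisRepresentations.HeckeCharacter.HasArchParams
    (ω : HeckeCharacter K) (P : ArchParams K) : Prop :=
  ∀ w : InfinitePlace K,
    (∀ hw : w.IsReal, HasRealParam hw (ω.archComponent w) (P.ν w) (P.ε w)) ∧
      (w.IsComplex → HasComplexParam (ω.archComponent w) (P.ν w) (P.k w))

/-- The trivial character has the zero parameters. [folklore] -/
theorem _root_.Literature.NumberTheory.GaloisRepresentations.HeckeCharacter.hasArchParams_one :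
    (1 : HeckeCharacter K).HasArchParams 0 := by
  intro w
  refine ⟨fun hw y => ?_, fun _ y => ?_⟩
  · simp
  · simp

end ArchComponent

/-! ### Archimedean `L`-factors of characters (Tate) -/

/-- Tate's archimedean `L`-factor of the character `‖·‖^ν sgn^ε` of `ℝˣ`:
`L(s, ‖·‖^ν sgn^ε) = Γ_ℝ(s + ν + ε)` (`ε ∈ {0, 1}`; Mathlib `Complex.Gammaℝ s = π^{-s/2} Γ(s/2)`).
Tate, Corvallis 1979, §3; the normalisation is the one of Booker–Krishnamurthy 2011, §4.2.1,
p. 683 (the case `π_v = π(μ₁, μ₂)`, `v ∈ S₀ ∪ S₁`: `L(s, π_v ⊗ ω_v) = L(s, μ₁ω_v) L(s, μ₂ω_v)` with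
these factors). [cite: BookerKrishnamurthy2011, §4.2.1 (p. 683)] -/
def archLFactorReal (ν : ℂ) (ε : Fin 2) (s : ℂ) : ℂ :=
  Gammaℝ (s + ν + ((ε : ℕ) : ℂ))

/-- Tate's archimedean `L`-factor of the character `‖·‖_ℂ^ν θ^k` of `ℂˣ` (`θ(y) = y / |y|`):
`L(s, ‖·‖_ℂ^ν θ^k) = Γ_ℂ(s + ν + |k|/2)` (Mathlib `Complex.Gammaℂ s = 2 (2π)^{-s} Γ(s)`).
Tate, Corvallis 1979, §3; normalisation of Booker–Krishnamurthy 2011, §4.2.2, p. 685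
(`L(s, π_v ⊗ ω_v) = Γ_ℂ(t + ν(π_v) + |l - k(π_v)|/4) Γ_ℂ(t - ν(π_v) + |l + k(π_v)|/4)`,
`t = s + ν(ω_{π_v})/2 + ν(ω_v)`, `l = -k(ω_{π_v}) - 2k(ω_v)`, which for `π_v = π(μ₁, μ₂)` is
`L(s, μ₁ω_v) L(s, μ₂ω_v)` with these factors). [cite: BookerKrishnamurthy2011, §4.2.2 (p. 685)] -/
def archLFactorComplex (ν : ℂ) (k : ℤ) (s : ℂ) : ℂ :=
  Gammaℂ (s + ν + ((|k| : ℤ) : ℂ) / 2)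

/-- `L(s, 1_ℝ) = Γ_ℝ(s)`. [folklore] -/
@[simp] theorem archLFactorReal_zero_zero (s : ℂ) : archLFactorReal 0 0 s = Gammaℝ s := by
  simp [archLFactorReal]

/-- `L(s, sgn) = Γ_ℝ(s + 1)`. [folklore] -/
@[simp] theorem archLFactorReal_zero_one (s : ℂ) : archLFactorReal 0 1 s = Gammaℝ (s + 1) := by
  simp [archLFactorReal]

/-- `L(s, 1_ℂ) = Γ_ℂ(s)`. [folklore] -/
@[simp] theorem archLFactorComplex_zero_zero (s : ℂ) : archLFactorComplex 0 0 s = Gammaℂ s := by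
  simp [archLFactorComplex]

/-! ### Twisted Artin `L`-functions `Λ(s, σ ⊗ ω)` -/

section Twist

variable {K : Type u} [Field K] [NumberField K] {V : Type*} [AddCommGroup V] [Module ℂ V]
  [TopologicalSpace V] [FiniteDimensional ℂ V]

/-- The **archimedean part of `Λ(s, σ ⊗ ω)`** for an Artin representation `σ` on `V` and an idèle
class character with archimedean parameters `P`. At a real place `w` with signature
`(n⁺, n⁻)` of `σ(c_w)` (accepted `ArtinRep.signature`), `σ_w ⊗ ω_w ≅ (ω_w)^{n⁺} ⊕ (sgn ω_w)^{n⁻}`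
with `ω_w = ‖·‖^ν sgn^ε`, whence the factor `Γ_ℝ(s + ν + ε)^{n⁺} Γ_ℝ(s + ν + ε')^{n⁻}`,
`ε' = ε + 1 mod 2`; at a complex place the decomposition group is trivial, `σ_w ⊗ ω_w ≅ ω_w^{dim V}`,
whence `Γ_ℂ(s + ν + |k|/2)^{dim V}` (additivity of archimedean `L`-factors, Tate 1979 §3;
Martinet 1977 §3 for `P = 0`; Booker–Krishnamurthy 2011 §4.2 for the factors).
[cite: MartinetDurham1977, §3] -/
def artinTwistGammaFactor (σ : ArtinRep K V) (P : ArchParams K) (s : ℂ) : ℂ :=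
  open scoped Classical in
  ∏ w : InfinitePlace K,
    if hw : w.IsReal then
      archLFactorReal (P.ν w) (P.ε w) s ^ (σ.signature (embedding_of_isReal hw)).1 *
        archLFactorReal (P.ν w) (P.ε w + 1) s ^ (σ.signature (embedding_of_isReal hw)).2
    else archLFactorComplex (P.ν w) (P.k w) s ^ finrank ℂ V

omit [FiniteDimensional ℂ V] in
/-- For the zero parameters (trivial `ω_∞`) the twisted archimedean factor is the accepted Artin
`Γ`-factor `γ(σ, s) = ∏_{w real} Γ_ℝ(s)^{n⁺_w} Γ_ℝ(s+1)^{n⁻_w} ∏_{w complex} Γ_ℂ(s)^{dim V}`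
(Martinet 1977, §3). [cite: MartinetDurham1977, §3] -/
theorem artinTwistGammaFactor_zero (σ : ArtinRep K V) :
    artinTwistGammaFactor σ 0 = σ.gammaFactor := by
  funext s
  unfold artinTwistGammaFactor ArtinRep.gammaFactor
  refine Finset.prod_congr rfl fun w _ => ?_
  split_ifs with hw <;> simp

/-- The **finite part of `Λ(s, σ ⊗ ω)`** for an idèle class character `ω` unramified at every
finite place: `L(s, σ ⊗ ω) = ∏_{v ∤ ∞} det(1 - ω_v(ϖ_v) q_v^{-s} · Frob_v | V^{I_v})⁻¹`, i.e. the
accepted local Euler factors `σ.eulerFactorAt v ∈ ℂ[T]` (inertia invariants, all finite places)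
evaluated at `T = ω_v(ϖ_v) q_v^{-s}` (accepted `ω.valueAtUniformizer v`, independent of the
uniformiser since `ω_v` is unramified; `(V ⊗ ω_v)^{I_v} = V^{I_v} ⊗ ω_v`), as an unconditional
product (`tprod`) exactly like the accepted `artinLFunction` (genuine value on `re s > 1`, where
the product converges absolutely for unitary `ω`). The `L`-function of the Weil-group
representation `σ ⊗ ω` (Jacquet–Langlands 1970, §12, as used in Booker–Krishnamurthy 2011, proof
of Cor. 1.2; Neukirch VII §10 for `ω = 1`). [cite: BookerKrishnamurthy2011, Cor. 1.2 (proof, p. 670)] -/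
def artinTwistLFunction (σ : ArtinRep K V) (ω : HeckeCharacter K) (s : ℂ) : ℂ :=
  ∏' v : HeightOneSpectrum (𝓞 K),
    ((σ.eulerFactorAt v).eval (ω.valueAtUniformizer v * (v.residueCard : ℂ) ^ (-s)))⁻¹

/-- The trivial idèle class character takes the value `1` at every uniformiser (local copy of
`HeckeCharacter.valueAtUniformizer_one` of `Automorphic/ArtinLFunctionsAbelianProofs`, not imported
to keep the import cone small). [folklore] -/
private theorem valueAtUniformizer_one_aux (v : HeightOneSpectrum (𝓞 K)) :
    (1 : HeckeCharacter K).valueAtUniformizer v = 1 := by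
  simp [HeckeCharacter.valueAtUniformizer]

/-- Untwisted case: `L(s, σ ⊗ 1)` is the accepted Artin `L`-function `artinLFunction σ`
(Artin 1930; Neukirch VII §10). [folklore] -/
theorem artinTwistLFunction_one (σ : ArtinRep K V) :
    artinTwistLFunction σ 1 = artinLFunction σ := by
  funext s
  simp [artinTwistLFunction, artinLFunction, valueAtUniformizer_one_aux]

/-- The **complete twisted `L`-function `Λ(s, σ ⊗ ω) = ∏_v L(s, σ_v ⊗ ω_v)`** of Booker–Krishnamurthy
(2011), Thm. 1.1 / Cor. 1.2, for a Galois representation `σ`, an idèle class character `ω`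
unramified at the finite places and archimedean parameters `P` of `ω`: the archimedean part
`artinTwistGammaFactor σ P` times the finite part `artinTwistLFunction σ ω` (no conductor power:
that enters `ε(s, ·)`, not `Λ`). [cite: BookerKrishnamurthy2011, Thm. 1.1 (p. 670)] -/
def artinTwistCompletedL (σ : ArtinRep K V) (P : ArchParams K) (ω : HeckeCharacter K) (s : ℂ) :
    ℂ :=
  artinTwistGammaFactor σ P s * artinTwistLFunction σ ω s

/-- Untwisted case: `Λ(s, σ ⊗ 1)` (zero parameters) is `γ(σ, s) · L(σ, s)`, the accepted completed
Artin `L`-function up to the conductor power `A(σ)^{s/2}`. [folklore] -/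
theorem artinTwistCompletedL_zero_one (σ : ArtinRep K V) :
    artinTwistCompletedL σ 0 1 = fun s => σ.gammaFactor s * artinLFunction σ s := by
  funext s
  rw [artinTwistCompletedL, artinTwistGammaFactor_zero, artinTwistLFunction_one]

/-- The trivial idèle class character is unramified at every finite place. [folklore] -/
theorem _root_.Literature.NumberTheory.GaloisRepresentations.HeckeCharacter.isUnramifiedAt_one
    (v : HeightOneSpectrum (𝓞 K)) : (1 : HeckeCharacter K).IsUnramifiedAt v :=
  fun _ => rfl

end Twist

/-! ### The named fact -/

/-- **Booker–Krishnamurthy 2011, Corollary 1.2 (Galois case): a two-dimensional Galois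
representation all of whose twists by everywhere-unramified idèle class characters have entire
complete `L`-functions is automorphic.** Printed (Compositio Math. 147 (2011), p. 670):
"Let `ρ : W_F → GL₂(ℂ)` be a representation of the Weil group of `F`. Suppose that the associated
`L`-functions `Λ(s, ρ ⊗ ω)` are entire for all idèle class characters `ω` that are unramified at
every non-archimedean place. Then `ρ` is automorphic, i.e. there is an automorphic representation
`π` such that `π_v` corresponds to `ρ_v` under the local Langlands correspondence for each place
`v`" (deduced there from Thm. 1.1, the `GL(2)` converse theorem with ARBITRARY poles allowed for
the twists ramified at some finite place). Rendered for `ρ = σ` a continuous `Γ_F → GL₂(ℂ)`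
(`FramedArtinRep F 2`; any number field `F`, `σ` not assumed irreducible): IF for every unitary
idèle class character `ω` of `F` unramified at every finite place and every family `P` of
archimedean parameters of `ω` (`ω.HasArchParams P`; it exists and is unique, op. cit. p. 672) the
complete twisted `L`-function `artinTwistCompletedL σ.toArtinRep P ω = Λ(s, σ ⊗ ω)` agrees on
`re s > 1` with an entire function (`LFunction.HasEntireContinuation`), THEN there is an automorphic
representation `π` of `GL₂(𝔸_F)` (Borel–Jacquet datum `AutomorphicRepData (AutomorphyDatum.gl 2 F hcpt)`,
not asserted cuspidal, op. cit. Remark (i)) with `π = π(σ)` in the accepted almost-everywhere sense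
`IsPiOfArtinRep σ π` (Satake parameters ↔ Frobenius eigenvalues off a finite set; weaker than the
printed "at each place"). Conventions (arithmetic Frobenius throughout; equivalent to the printed
statement for `σ^∨`): module docstring. Over `F = ℚ` such `ω` are the `|·|^{it}` and one recovers
Booker 2003 (cf. `Automorphic/BookerStrongArtin`). [cite: BookerKrishnamurthy2011, Cor. 1.2 (p. 670)] -/
def bookerKrishnamurthy_isPiOfArtinRep_of_entire_twists : Prop :=
  ∀ (F : Type) [Field F] [NumberField F] (σ : FramedArtinRep F 2),
    (∀ (ω : HeckeCharacter F), ω.IsUnitary → (∀ v : HeightOneSpectrum (𝓞 F), ω.IsUnramifiedAt v) →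
      ∀ P : ArchParams F, ω.HasArchParams P →
        LFunction.HasEntireContinuation (artinTwistCompletedL σ.toArtinRep P ω)) →
    ∃ (hcpt : isCompact_glFiniteIntegralLevel 2 F) (π : AutomorphicRepData (AutomorphyDatum.gl 2 F hcpt)),
      IsPiOfArtinRep σ π

/-- The `ω = 1` instance of the hypothesis of `bookerKrishnamurthy_isPiOfArtinRep_of_entire_twists`
is Artin's conjecture for `σ` in the form "`γ(σ, s) L(σ, s)` is entire" (the trivial character is
unitary, everywhere unramified, with zero archimedean parameters). In particular the fact contains
"Artin for all everywhere-unramified unitary twists ⇒ strong Artin (a.e. form)" over any number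
field. [folklore] -/
theorem hasEntireContinuation_of_hypothesis {F : Type} [Field F] [NumberField F]
    (σ : FramedArtinRep F 2)
    (h : ∀ (ω : HeckeCharacter F), ω.IsUnitary →
      (∀ v : HeightOneSpectrum (𝓞 F), ω.IsUnramifiedAt v) →
      ∀ P : ArchParams F, ω.HasArchParams P →
        LFunction.HasEntireContinuation (artinTwistCompletedL σ.toArtinRep P ω)) :
    LFunction.HasEntireContinuation
      fun s => σ.toArtinRep.gammaFactor s * artinLFunction σ.toArtinRep s := by
  have h1 := h 1 HeckeCharacter.isUnitary_one HeckeCharacter.isUnramifiedAt_one 0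
    HeckeCharacter.hasArchParams_one
  rwa [artinTwistCompletedL_zero_one] at h1

end Literature.NumberTheory.Automorphic

end
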